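import Mathlib
import Summits.Parity.GeneralizedHardyLittlewood.Theorems.LiouvilleShiftedTablesPairsToGHLStubToBoundedAux1

/-!
# Green–Tao normalisation in dimension one, II: from `[1, M]`-sums to intervals
# (crux `PairsToGHL`, stmt-Parity-9389, line `sloped_ladder`, stub `stub_toBounded`)

The counting layer of the deduction "elementary Hardy–Littlewood on `[1, N]`" ⇒ `BoundedDickson`
(Green–Tao 2010, (1.2)–(1.4), `d = 1`), for a non-negative weight `G : ℤ → ℝ` with the uniform
estimate `|∑_{c < n ≤ c + M} G(n) − 𝔖 M| ≤ η M + C` (all `M`):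

* `abs_sum_Ioc_sub_le` — the same on every `(u, v]` with `c ≤ u ≤ v` (difference of two sums);
* `window_tail_estimate` — on an integer interval `[m₁, m₂]` with `m₁ > L`: the part below `c`
  lives in the FIXED window `(L, c]`, the rest is a tail `(c, m₂]`;
* `lattice_vs_volume` — for order-connected `K' ⊆ [-N, N]` and an order-connected set `P`
  carrying the weight: `|∑_{m ∈ K' ∩ ℤ} F(m) − vol(K' ∩ P)·𝔖| ≤ E + |𝔖|` as soon as every integer
  interval with end-points in `P` obeys `|∑ F − 𝔖·#| ≤ E` (lattice points of `K' ∩ P` form an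
  interval whose length is `vol(K' ∩ P) + O(1)`, tree lemma `DimOne.exists_filter_eq_Icc`);
* `interval_estimate` — the interval hypothesis of `lattice_vs_volume` for the tuple weight of a
  system all of whose slopes have the sign `u = ±1` (for `u = -1` reflect `n ↦ -n`).

References: B. Green, T. Tao, *Linear equations in primes*, Ann. of Math. 171 (2010), (1.2)–(1.4),
App. A.
-/

namespace Summit.Parity.GeneralizedHardyLittlewood.Theorems.PairsToGHL.SlopedLadder

namespace ToBounded

open Finset Filter MeasureTheory
open Literature.NumberTheory.Sieve

noncomputable section

variable {t : ℕ}

/-! ### Integer intervals -/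

/-- `#[a, b] = b + 1 - a` (as a real number) for `a ≤ b + 1`. [folklore] -/
theorem card_Icc_int_real {a b : ℤ} (h : a ≤ b + 1) : (#(Finset.Icc a b) : ℝ) = b + 1 - a := by
  rw [Int.card_Icc]
  have h1 : ((b + 1 - a).toNat : ℤ) = b + 1 - a := Int.toNat_of_nonneg (by omega)
  have h2 : (((b + 1 - a).toNat : ℕ) : ℝ) = ((b + 1 - a : ℤ) : ℝ) := by exact_mod_cast h1
  rw [h2]
  push_cast
  ring

/-- `#(a, b] = b - a` (as a real number) for `a ≤ b`. [folklore] -/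
theorem card_Ioc_int_real {a b : ℤ} (h : a ≤ b) : (#(Finset.Ioc a b) : ℝ) = b - a := by
  rw [Int.card_Ioc]
  have h1 : ((b - a).toNat : ℤ) = b - a := Int.toNat_of_nonneg (by omega)
  have h2 : (((b - a).toNat : ℕ) : ℝ) = ((b - a : ℤ) : ℝ) := by exact_mod_cast h1
  rw [h2]
  push_cast
  ring

/-- `|s x| ≤ |s| k` for `0 ≤ x ≤ k`. [folklore] -/
theorem abs_mul_le_of_le {s x k : ℝ} (hx0 : 0 ≤ x) (hxk : x ≤ k) : |s * x| ≤ |s| * k := by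
  rw [abs_mul, abs_of_nonneg hx0]
  exact mul_le_mul_of_nonneg_left hxk (abs_nonneg s)

/-- **Sums over `(u, v]` from sums over `(c, c + M]`.** If `|∑_{c < n ≤ c+M} G − 𝔖 M| ≤ η M + C`
for all `M`, then `|∑_{u < n ≤ v} G − 𝔖 (v − u)| ≤ η((u − c) + (v − c)) + 2C` for `c ≤ u ≤ v`.
[folklore] -/
theorem abs_sum_Ioc_sub_le {G : ℤ → ℝ} {𝔖 η C : ℝ} {c : ℤ}
    (hS : ∀ M : ℕ, |∑ n ∈ Finset.Ioc c (c + M), G n - 𝔖 * M| ≤ η * M + C)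
    {u v : ℤ} (hcu : c ≤ u) (huv : u ≤ v) :
    |∑ n ∈ Finset.Ioc u v, G n - 𝔖 * ((v : ℝ) - u)| ≤ η * (((u : ℝ) - c) + ((v : ℝ) - c)) + 2 * C := by
  have h1 := hS (u - c).toNat
  have h2 := hS (v - c).toNat
  have e1 : ((u - c).toNat : ℤ) = u - c := Int.toNat_of_nonneg (by omega)
  have e2 : ((v - c).toNat : ℤ) = v - c := Int.toNat_of_nonneg (by omega)
  have e1' : (((u - c).toNat : ℕ) : ℝ) = ((u - c : ℤ) : ℝ) := by exact_mod_cast e1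
  have e2' : (((v - c).toNat : ℕ) : ℝ) = ((v - c : ℤ) : ℝ) := by exact_mod_cast e2
  rw [show c + (((u - c).toNat : ℕ) : ℤ) = u by omega, e1'] at h1
  rw [show c + (((v - c).toNat : ℕ) : ℤ) = v by omega, e2'] at h2
  push_cast at h1 h2
  have hsplit : ∑ n ∈ Finset.Ioc c v, G n = ∑ n ∈ Finset.Ioc c u, G n + ∑ n ∈ Finset.Ioc u v, G n := by
    rw [← Finset.sum_union (Finset.Ioc_disjoint_Ioc_of_le le_rfl), Finset.Ioc_union_Ioc_eq_Ioc hcu huv]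
  rw [hsplit] at h2
  rw [abs_le] at h1 h2 ⊢
  constructor <;> linarith [h1.1, h1.2, h2.1, h2.2]

/-- **Window and tail.** Let `G ≥ 0` satisfy `|∑_{c < n ≤ c+M} G − 𝔖 M| ≤ η M + C` for all `M`
(`η ≥ 0`). Then for integers `m₁ ≤ m₂` with `m₁ > L`,
`|∑_{m₁ ≤ n ≤ m₂} G(n) − 𝔖 #[m₁, m₂]| ≤ η(2|m₂| + 2|c|) + 2C + ∑_{L < n ≤ c} G(n) + |𝔖| #(L, c]`:
the part of `[m₁, m₂]` below `c` lies in the fixed window `(L, c]`, the rest is the tail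
`(c, m₂]`. [cite: GreenTao2010, App. A] -/
theorem window_tail_estimate {G : ℤ → ℝ} (hG : ∀ n, 0 ≤ G n) {𝔖 η C : ℝ} {c L : ℤ} (hη : 0 ≤ η)
    (hS : ∀ M : ℕ, |∑ n ∈ Finset.Ioc c (c + M), G n - 𝔖 * M| ≤ η * M + C)
    {m₁ m₂ : ℤ} (hle : m₁ ≤ m₂) (hL : L < m₁) :
    |∑ n ∈ Finset.Icc m₁ m₂, G n - 𝔖 * #(Finset.Icc m₁ m₂)| ≤
      η * (2 * |(m₂ : ℝ)| + 2 * |(c : ℝ)|) + 2 * C + ∑ n ∈ Finset.Ioc L c, G n +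
        |𝔖| * #(Finset.Ioc L c) := by
  have hC : 0 ≤ C := by
    have := hS 0
    simp only [Nat.cast_zero, add_zero, Finset.Ioc_self, Finset.sum_empty, mul_zero, sub_zero,
      abs_zero, zero_add] at this
    exact this
  set W := ∑ n ∈ Finset.Ioc L c, G n with hW
  have hW0 : 0 ≤ W := Finset.sum_nonneg fun n _ => hG n
  have hk0 : (0 : ℝ) ≤ #(Finset.Ioc L c) := Nat.cast_nonneg _
  have h𝔖k : 0 ≤ |𝔖| * #(Finset.Ioc L c) := mul_nonneg (abs_nonneg _) hk0
  have hm₂abs : (m₂ : ℝ) ≤ |(m₂ : ℝ)| := le_abs_self _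
  have hcabs : -(c : ℝ) ≤ |(c : ℝ)| := neg_le_abs _
  have hle' : (m₁ : ℝ) ≤ m₂ := by exact_mod_cast hle
  rcases le_or_gt c (m₁ - 1) with hc | hc
  · -- pure tail: `[m₁, m₂] = (m₁ - 1, m₂]`
    have hIcc : Finset.Icc m₁ m₂ = Finset.Ioc (m₁ - 1) m₂ := by
      ext n
      simp only [Finset.mem_Icc, Finset.mem_Ioc]
      omega
    have h := abs_sum_Ioc_sub_le hS hc (show m₁ - 1 ≤ m₂ by omega)
    rw [hIcc, card_Ioc_int_real (show m₁ - 1 ≤ m₂ by omega)]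
    push_cast at h ⊢
    have hc' : (c : ℝ) ≤ m₁ - 1 := by exact_mod_cast (show c ≤ m₁ - 1 from hc)
    have hb : η * ((m₁ : ℝ) - 1 - c + (m₂ - c)) ≤ η * (2 * |(m₂ : ℝ)| + 2 * |(c : ℝ)|) :=
      mul_le_mul_of_nonneg_left (by linarith) hη
    rw [abs_le] at h ⊢
    constructor <;> linarith [h.1, h.2]
  · -- window `[m₁, min c m₂]` and tail `(c, m₂]`
    have hkL : ((m₁ : ℝ)) - 1 - L ≥ 0 := by
      have : L ≤ m₁ - 1 := by omega
      have : (L : ℝ) ≤ m₁ - 1 := by exact_mod_cast this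
      linarith
    have hkc : (#(Finset.Ioc L c) : ℝ) = c - L := card_Ioc_int_real (by omega)
    rcases le_or_gt m₂ c with hm₂c | hm₂c
    · -- everything in the window
      have hsub : Finset.Icc m₁ m₂ ⊆ Finset.Ioc L c := by
        intro n hn
        simp only [Finset.mem_Icc, Finset.mem_Ioc] at hn ⊢
        omega
      have hA0 : 0 ≤ ∑ n ∈ Finset.Icc m₁ m₂, G n := Finset.sum_nonneg fun n _ => hG n
      have hAW : ∑ n ∈ Finset.Icc m₁ m₂, G n ≤ W :=
        Finset.sum_le_sum_of_subset_of_nonneg hsub fun n _ _ => hG n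
      rw [card_Icc_int_real (by omega)]
      have hcard0 : (0 : ℝ) ≤ m₂ + 1 - m₁ := by linarith
      have hcardk : (m₂ : ℝ) + 1 - m₁ ≤ #(Finset.Ioc L c) := by
        rw [hkc]
        have h1 : (m₂ : ℝ) ≤ c := by exact_mod_cast hm₂c
        have h2 : (L : ℝ) ≤ m₁ - 1 := by exact_mod_cast (show L ≤ m₁ - 1 by omega)
        linarith
      have h𝔖 := abs_mul_le_of_le (s := 𝔖) hcard0 hcardk
      have hη0 : 0 ≤ η * (2 * |(m₂ : ℝ)| + 2 * |(c : ℝ)|) := by positivity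
      rw [abs_le] at h𝔖 ⊢
      constructor <;> linarith [h𝔖.1, h𝔖.2]
    · -- genuine split at `c`
      have hsplit : Finset.Icc m₁ m₂ = Finset.Icc m₁ c ∪ Finset.Ioc c m₂ := by
        ext n
        simp only [Finset.mem_Icc, Finset.mem_union, Finset.mem_Ioc]
        omega
      have hdisj : Disjoint (Finset.Icc m₁ c) (Finset.Ioc c m₂) := by
        rw [Finset.disjoint_left]
        intro n hn hn'
        simp only [Finset.mem_Icc] at hn
        simp only [Finset.mem_Ioc] at hn'
        omega
      have hsub : Finset.Icc m₁ c ⊆ Finset.Ioc L c := by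
        intro n hn
        simp only [Finset.mem_Icc, Finset.mem_Ioc] at hn ⊢
        omega
      have hA0 : 0 ≤ ∑ n ∈ Finset.Icc m₁ c, G n := Finset.sum_nonneg fun n _ => hG n
      have hAW : ∑ n ∈ Finset.Icc m₁ c, G n ≤ W :=
        Finset.sum_le_sum_of_subset_of_nonneg hsub fun n _ _ => hG n
      have htail := abs_sum_Ioc_sub_le hS le_rfl hm₂c.le
      rw [card_Icc_int_real (show m₁ ≤ m₂ + 1 by omega), hsplit, Finset.sum_union hdisj]
      have hcard0 : (0 : ℝ) ≤ c + 1 - m₁ := by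
        have : (m₁ : ℝ) - 1 < c := by exact_mod_cast hc
        linarith
      have hcardk : (c : ℝ) + 1 - m₁ ≤ #(Finset.Ioc L c) := by
        rw [hkc]
        have h2 : (L : ℝ) ≤ m₁ - 1 := by exact_mod_cast (show L ≤ m₁ - 1 by omega)
        linarith
      have h𝔖 := abs_mul_le_of_le (s := 𝔖) hcard0 hcardk
      have hcm : (c : ℝ) < m₂ := by exact_mod_cast hm₂c
      have hb : η * ((c : ℝ) - c + (m₂ - c)) ≤ η * (2 * |(m₂ : ℝ)| + 2 * |(c : ℝ)|) :=
        mul_le_mul_of_nonneg_left (by linarith) hη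
      rw [abs_le] at h𝔖 htail ⊢
      constructor <;> linarith [h𝔖.1, h𝔖.2, htail.1, htail.2]

/-! ### Lattice points versus volume -/

open Classical in
/-- **Lattice points versus volume.** Let `F : ℤ → ℝ` vanish at integers outside an
order-connected set `P ⊆ ℝ`, let `K' ⊆ [-N, N]` be order-connected, and suppose every integer
interval `[m₁, m₂] ⊆ [-N, N]` with end-points in `P` satisfies `|∑_{[m₁,m₂]} F − 𝔖 #[m₁,m₂]| ≤ E`
(`E ≥ 0`). Then `|∑_{m ∈ K' ∩ ℤ} F(m) − vol(K' ∩ P) 𝔖| ≤ E + |𝔖|`: the integers of `K'` carrying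
weight are the lattice points of the interval `K' ∩ P`, which form an integer interval of
`vol(K' ∩ P) + O(1)` points (`DimOne.exists_filter_eq_Icc`). [cite: GreenTao2010, App. A] -/
theorem lattice_vs_volume {F : ℤ → ℝ} {P K' : Set ℝ} {N : ℕ} {𝔖 E : ℝ}
    (hF0 : ∀ n : ℤ, (n : ℝ) ∉ P → F n = 0) (hP : P.OrdConnected) (hK : K'.OrdConnected)
    (hKN : K' ⊆ Set.Icc (-(N : ℝ)) N) (hE : 0 ≤ E)
    (hint : ∀ m₁ m₂ : ℤ, m₁ ≤ m₂ → -(N : ℤ) ≤ m₁ → m₂ ≤ N → (m₁ : ℝ) ∈ P → (m₂ : ℝ) ∈ P →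
      |∑ n ∈ Finset.Icc m₁ m₂, F n - 𝔖 * #(Finset.Icc m₁ m₂)| ≤ E) :
    |∑ m ∈ (Finset.Icc (-(N : ℤ)) N).filter (fun m : ℤ => (m : ℝ) ∈ K'), F m -
        (volume (K' ∩ P)).toReal * 𝔖| ≤ E + |𝔖| := by
  have hS : (K' ∩ P).OrdConnected := hK.inter hP
  have hSN : K' ∩ P ⊆ Set.Icc (-(N : ℝ)) N := fun r hr => hKN hr.1
  obtain ⟨m₁, m₂, hI, hvol⟩ := DimOne.exists_filter_eq_Icc (N := N) hS hSN
  -- restrict the sum to `K' ∩ P`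
  have hsum : ∑ m ∈ (Finset.Icc (-(N : ℤ)) N).filter (fun m : ℤ => (m : ℝ) ∈ K'), F m =
      ∑ m ∈ (Finset.Icc (-(N : ℤ)) N).filter (fun m : ℤ => (m : ℝ) ∈ K' ∩ P), F m := by
    refine (Finset.sum_subset (fun m hm => ?_) (fun m hm hm' => ?_)).symm
    · rw [Finset.mem_filter] at hm ⊢
      exact ⟨hm.1, hm.2.1⟩
    · rw [Finset.mem_filter] at hm hm'
      refine hF0 m fun hmP => hm' ⟨hm.1, ?_⟩
      exact ⟨hm.2, hmP⟩
  have hI' : (Finset.Icc (-(N : ℤ)) N).filter (fun m : ℤ => (m : ℝ) ∈ K' ∩ P) = Finset.Icc m₁ m₂ := by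
    ext m
    rw [← hI]
  rw [hsum, hI']
  have hv0 : 0 ≤ (volume (K' ∩ P)).toReal := ENNReal.toReal_nonneg
  rcases lt_or_ge m₂ m₁ with hlt | hle
  · -- no lattice point: `vol ≤ 1`
    rw [Finset.Icc_eq_empty_of_lt hlt] at hvol ⊢
    rw [Finset.card_empty, Nat.cast_zero, zero_sub, abs_neg, abs_of_nonneg hv0] at hvol
    rw [Finset.sum_empty, zero_sub, abs_neg, abs_mul, abs_of_nonneg hv0]
    calc (volume (K' ∩ P)).toReal * |𝔖| ≤ 1 * |𝔖| := mul_le_mul_of_nonneg_right hvol (abs_nonneg _)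
      _ ≤ E + |𝔖| := by linarith
  · have hm₁ : m₁ ∈ Finset.Icc m₁ m₂ := Finset.left_mem_Icc.mpr hle
    have hm₂ : m₂ ∈ Finset.Icc m₁ m₂ := Finset.right_mem_Icc.mpr hle
    rw [← hI', Finset.mem_filter, Finset.mem_Icc] at hm₁ hm₂
    have h := hint m₁ m₂ hle hm₁.1.1 hm₂.1.2 hm₁.2.2 hm₂.2.2
    have h2 : |𝔖 * #(Finset.Icc m₁ m₂) - (volume (K' ∩ P)).toReal * 𝔖| ≤ |𝔖| := by
      rw [mul_comm _ 𝔖, ← mul_sub, abs_mul]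
      exact mul_le_of_le_one_right (abs_nonneg _) hvol
    calc |∑ n ∈ Finset.Icc m₁ m₂, F n - (volume (K' ∩ P)).toReal * 𝔖|
        = |(∑ n ∈ Finset.Icc m₁ m₂, F n - 𝔖 * #(Finset.Icc m₁ m₂)) +
            (𝔖 * #(Finset.Icc m₁ m₂) - (volume (K' ∩ P)).toReal * 𝔖)| := by ring_nf
      _ ≤ |∑ n ∈ Finset.Icc m₁ m₂, F n - 𝔖 * #(Finset.Icc m₁ m₂)| +
            |𝔖 * #(Finset.Icc m₁ m₂) - (volume (K' ∩ P)).toReal * 𝔖| := abs_add_le _ _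
      _ ≤ E + |𝔖| := add_le_add h h2

/-! ### The interval hypothesis for a one-signed system -/

/-- Reflection of an interval sum of the tuple weight:
`∑_{m₁ ≤ n ≤ m₂} F_Φ(n) = ∑_{-m₂ ≤ n ≤ -m₁} F_Φ(-n)`. [folklore] -/
theorem sum_Icc_reflect (Φ : Fin t → AffLinForm 1) (m₁ m₂ : ℤ) :
    ∑ n ∈ Finset.Icc m₁ m₂, ∏ i, intVonMangoldt ((Φ i).coeff 0 * n + (Φ i).const) =
      ∑ n ∈ Finset.Icc (-m₂) (-m₁), ∏ i, intVonMangoldt ((Φ i).coeff 0 * (-n) + (Φ i).const) := by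
  refine Finset.sum_nbij' (fun n => -n) (fun n => -n) (fun n hn => ?_) (fun n hn => ?_)
    (fun n _ => by ring) (fun n _ => by ring) (fun n _ => by rw [neg_neg])
  · simp only [Finset.mem_Icc] at hn ⊢
    omega
  · simp only [Finset.mem_Icc] at hn ⊢
    omega

/-- **The interval hypothesis of `lattice_vs_volume` for a one-signed system.** If all slopes
have the sign `u = ±1` (witnessed by one form `j`) and the substituted ladder estimate
`|∑_{c < n ≤ c+M} F_Φ(u n) − 𝔖 M| ≤ η M + C` holds for all `M`, then every integer interval
`[m₁, m₂] ⊆ [-N, N]` with end-points in the positivity set satisfies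
`|∑_{[m₁,m₂]} F_Φ − 𝔖 #[m₁,m₂]| ≤ η(2N + 2|c|) + 2C + W + |𝔖| #(L, c]` with the fixed window
`(L, c]`, `L = -|bⱼ|`, and `W = ∑_{L < n ≤ c} F_Φ(u n)` (for `u = -1` reflect `n ↦ -n`).
[cite: GreenTao2010, App. A] -/
theorem interval_estimate {Φ : Fin t → AffLinForm 1} {u : ℤ} (hu : u = 1 ∨ u = -1) {j : Fin t}
    (hj : 0 < u * (Φ j).coeff 0) {𝔖 η C : ℝ} {c : ℤ} (hη : 0 ≤ η)
    (hS : ∀ M : ℕ, |∑ n ∈ Finset.Ioc c (c + M),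
      ∏ i, intVonMangoldt ((Φ i).coeff 0 * (u * n) + (Φ i).const) - 𝔖 * M| ≤ η * M + C)
    {N : ℕ} {m₁ m₂ : ℤ} (hle : m₁ ≤ m₂) (h1 : -(N : ℤ) ≤ m₁) (h2 : m₂ ≤ N)
    (hm₁ : (m₁ : ℝ) ∈ {r : ℝ | ∀ i, 0 < ((Φ i).coeff 0 : ℝ) * r + ((Φ i).const : ℝ)})
    (hm₂ : (m₂ : ℝ) ∈ {r : ℝ | ∀ i, 0 < ((Φ i).coeff 0 : ℝ) * r + ((Φ i).const : ℝ)}) :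
    |∑ n ∈ Finset.Icc m₁ m₂, ∏ i, intVonMangoldt ((Φ i).coeff 0 * n + (Φ i).const) -
        𝔖 * #(Finset.Icc m₁ m₂)| ≤
      η * (2 * N + 2 * |(c : ℝ)|) + 2 * C +
        ∑ n ∈ Finset.Ioc (-|(Φ j).const|) c, ∏ i, intVonMangoldt ((Φ i).coeff 0 * (u * n) + (Φ i).const) +
          |𝔖| * #(Finset.Ioc (-|(Φ j).const|) c) := by
  have hL₁ := lt_mul_of_mem_posSet Φ hu hj hm₁
  have hL₂ := lt_mul_of_mem_posSet Φ hu hj hm₂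
  rcases hu with rfl | rfl
  · simp only [one_mul] at hS hL₁ ⊢
    have h := window_tail_estimate (fun n => tupleWeight_nonneg Φ n) hη hS hle hL₁
    have hm₂N : |(m₂ : ℝ)| ≤ N := by
      rw [abs_le]
      constructor
      · exact_mod_cast (show -(N : ℤ) ≤ m₂ by omega)
      · exact_mod_cast h2
    have hb : η * (2 * |(m₂ : ℝ)| + 2 * |(c : ℝ)|) ≤ η * (2 * N + 2 * |(c : ℝ)|) :=
      mul_le_mul_of_nonneg_left (by linarith) hη
    linarith
  · simp only [neg_one_mul] at hS hL₂ ⊢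
    have hle' : -m₂ ≤ -m₁ := by omega
    have h := window_tail_estimate
      (G := fun n => ∏ i, intVonMangoldt ((Φ i).coeff 0 * (-n) + (Φ i).const))
      (fun n => tupleWeight_nonneg Φ _) hη hS hle' hL₂
    have hcard : #(Finset.Icc (-m₂) (-m₁)) = #(Finset.Icc m₁ m₂) := by
      rw [Int.card_Icc, Int.card_Icc]
      omega
    rw [← sum_Icc_reflect Φ m₁ m₂, hcard] at h
    have hm₁N : |((-m₁ : ℤ) : ℝ)| ≤ N := by
      rw [abs_le]
      push_cast
      constructor
      · have : (m₁ : ℝ) ≤ N := by exact_mod_cast (show m₁ ≤ (N : ℤ) by omega)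
        linarith
      · have : (-(N : ℤ) : ℝ) ≤ m₁ := by exact_mod_cast h1
        push_cast at this
        linarith
    have hb : η * (2 * |((-m₁ : ℤ) : ℝ)| + 2 * |(c : ℝ)|) ≤ η * (2 * N + 2 * |(c : ℝ)|) :=
      mul_le_mul_of_nonneg_left (by linarith) hη
    linarith

end

end ToBounded

/-! ### Registered sub-goal of this helper file -/

/-- **Part 2 of `stub_toBounded` (registered sub-goal `stub_toBounded_part2`).** Window and tail:
from the uniform `(c, c + M]`-estimate for a non-negative weight `G` to every integer interval
`[m₁, m₂]` above a fixed level `L` (the part below `c` lives in the fixed window `(L, c]`).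
[cite: GreenTao2010, App. A] -/
theorem stub_toBounded_part2 :
    ∀ (G : ℤ → ℝ) (S η C : ℝ) (c L m₁ m₂ : ℤ), (∀ n, 0 ≤ G n) → 0 ≤ η → (∀ M : ℕ, |∑ n ∈ Finset.Ioc c (c + M), G n - S * M| ≤ η * M + C) → m₁ ≤ m₂ → L < m₁ → |∑ n ∈ Finset.Icc m₁ m₂, G n - S * (Finset.Icc m₁ m₂).card| ≤ η * (2 * |(m₂ : ℝ)| + 2 * |(c : ℝ)|) + 2 * C + ∑ n ∈ Finset.Ioc L c, G n + |S| * (Finset.Ioc L c).card :=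
  fun _ _ _ _ _ _ _ _ hG hη hS hle hL => ToBounded.window_tail_estimate hG hη hS hle hL

end Summit.Parity.GeneralizedHardyLittlewood.Theorems.PairsToGHL.SlopedLadder
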